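import Summits.Ventures.DiscreteObjects.Hadamard.Order6NegaCore
import Summits.Ventures.DiscreteObjects.Hadamard.Order6Orbits
import Summits.Ventures.DiscreteObjects.Hadamard.Order4Nega4q

/-!
# H(4q), q ≡ 11 (mod 12) prime: AN ORDER-6 AUTOMORPHISM WITH FIXED-POINT-FREE CUBE HAS AN EVEN NUMBER OF 6-CYCLES (kernel)

Framing: lottery ticket; floor = certified bounds/negative ranges.

Cell pub-namedobj (venture DiscreteObjects), target (H), hadamard gen 14; HANDOFF-H-g13 open item 3.  Transfer from an arbitrary
signed automorphism `(π, κ, d, e)` of a Hadamard matrix of order `4q` (`q ≡ 11 (mod 12)` prime: the open orders `668 = 4·167`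
and `716 = 4·179`) with `π⁶ = κ⁶ = 1` and `π³, κ³` fixed-point-free to the block normal form of `Order6NegaCore`:
* the cube `(π³, κ³, d·d∘π·d∘π², …)` is a fixed-point-free involution pair, hence NEGA (`fpf_involution_nega_general`), so every
  cycle of `π` (of length `6` or `2`) has cycle sign product `−1`;
* orbit minima (`perm62_bijective`) give `(Fin 6 × R₆) ⊕ (Fin 2 × R₂) ≃ ι` on rows and on columns; the numbers of `2`-cycles of
  `π` and `κ` agree by the trace lemma `signedAut_trace` applied to `g²` (each fixed point of `π²` contributes `d i · d (π i) = −1`),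
  hence so do the numbers of `6`-cycles;
* the re-signing `δ (p, c) = ∏_{k<p} d (π^k c)` transports `H` to an equivalent Hadamard matrix on `(Fin 6 × R₆) ⊕ (Fin 2 × R₂)`
  carrying the standard nega order-6 automorphism, and `no_hadamard4q_nega6_blockform` forbids `|R₆|` odd.
Results: `hadamard4q_nega6` (explicit nega cycle signs), **`hadamard4q_aut_order6_cube_fpf`** (`π⁶ = κ⁶ = 1`, `π³`, `κ³`
fixed-point-free ⇒ `12 ∣ #{i | π² i ≠ i}` and `12 ∣ #{j | κ² j ≠ j}`, i.e. the numbers of `6`-cycles are even), and the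
instances **`hadamard668_aut_order6_cube_fpf`** (`#Fix(π²) ≡ 8 (mod 12)`) and `hadamard716_aut_order6_cube_fpf`.
What it does NOT say: automorphisms of order `6` are not excluded; for `g³` of type I (not fixed-point-free) nothing is claimed.
Ours; no `sorry`.
-/

namespace Summit.Ventures.DiscreteObjects.Hadamard

open Finset BigOperators Matrix

open Literature.Combinatorics.Designs.GoethalsSeidel (IsHadamardMatrix)

section transfer6ord
variable {ι : Type*} [Fintype ι] [LinearOrder ι]

/-- **Transfer to the block normal form** (ordered index type).  For a Hadamard matrix of order `4q`, `q ≡ 11 (mod 12)` prime, and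
a signed automorphism `(π, κ, d, e)` with `π⁶ = κ⁶ = 1`, `π³, κ³` fixed-point-free and nega cycle signs (the product of `d` over
`i, π i, …, π⁵ i` is `−1`, likewise for `e`), the number of rows moved by `π²` is divisible by `12` (the number of `6`-cycles of
`π` is even).  (Here `DecidableEq ι` comes from the linear order, as in `Order6Orbits`.) -/
theorem hadamard4q_nega6_ord {q : ℕ} (hq : q.Prime) (hq12 : q % 12 = 11) {H : Matrix ι ι ℤ}
    (hH : IsHadamardMatrix H) (hι : Fintype.card ι = 4 * q) {π κ : Equiv.Perm ι} {d e : ι → ℤ}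
    (haut : IsSignedAut H π κ d e)
    (hπ6 : ∀ i, π (π (π (π (π (π i))))) = i) (hκ6 : ∀ j, κ (κ (κ (κ (κ (κ j))))) = j)
    (hπ3 : ∀ i, π (π (π i)) ≠ i) (hκ3 : ∀ j, κ (κ (κ j)) ≠ j)
    (hdneg : ∀ i, d i * d (π i) * d (π (π i)) * d (π (π (π i))) * d (π (π (π (π i)))) *
      d (π (π (π (π (π i))))) = -1)
    (heneg : ∀ j, e j * e (κ j) * e (κ (κ j)) * e (κ (κ (κ j))) * e (κ (κ (κ (κ j)))) *
      e (κ (κ (κ (κ (κ j))))) = -1) :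
    12 ∣ (univ.filter (fun i => π (π i) ≠ i)).card := by
  have hd := haut.1
  have he := haut.2.1
  have hA := haut.2.2
  have pm_mul : ∀ {a b : ℤ}, (a = 1 ∨ a = -1) → (b = 1 ∨ b = -1) → (a * b = 1 ∨ a * b = -1) := by
    intro a b ha hb
    rcases ha with h | h <;> rcases hb with h' | h' <;> simp [h, h']
  have hq0 : 0 < q := hq.pos
  have hcardι : (Fintype.card ι : ℤ) ≠ 0 := by rw [hι]; push_cast; positivity
  -- signs on the 2-cycles
  have hd2 : ∀ i, π (π i) = i → d i * d (π i) = -1 := by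
    intro i h2
    have h := hdneg i
    rw [h2, h2] at h
    rcases hd i with a | a <;> rcases hd (π i) with b | b <;> simp [a, b] at h ⊢
  have he2 : ∀ j, κ (κ j) = j → e j * e (κ j) = -1 := by
    intro j h2
    have h := heneg j
    rw [h2, h2] at h
    rcases he j with a | a <;> rcases he (κ j) with b | b <;> simp [a, b] at h ⊢
  -- the orbit bijections
  set R₆ := univ.filter (fun c => π (π c) ≠ c ∧ ∀ p : Fin 6, c ≤ (π ^ (p : ℕ)) c) with hR₆
  set R₂ := univ.filter (fun c => π (π c) = c ∧ ∀ p : Fin 6, c ≤ (π ^ (p : ℕ)) c) with hR₂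
  set C₆ := univ.filter (fun c => κ (κ c) ≠ c ∧ ∀ p : Fin 6, c ≤ (κ ^ (p : ℕ)) c) with hC₆
  set C₂ := univ.filter (fun c => κ (κ c) = c ∧ ∀ p : Fin 6, c ≤ (κ ^ (p : ℕ)) c) with hC₂
  let φr : (Fin 6 × {c // c ∈ R₆}) ⊕ (Fin 2 × {c // c ∈ R₂}) → ι :=
    Sum.elim (fun x => (π ^ (x.1 : ℕ)) x.2.1) (fun x => (π ^ (x.1 : ℕ)) x.2.1)
  let φc : (Fin 6 × {c // c ∈ C₆}) ⊕ (Fin 2 × {c // c ∈ C₂}) → ι :=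
    Sum.elim (fun x => (κ ^ (x.1 : ℕ)) x.2.1) (fun x => (κ ^ (x.1 : ℕ)) x.2.1)
  have hbr : Function.Bijective φr := perm62_bijective π hπ6 hπ3
  have hbc : Function.Bijective φc := perm62_bijective κ hκ6 hκ3
  let eR : (Fin 6 × {c // c ∈ R₆}) ⊕ (Fin 2 × {c // c ∈ R₂}) ≃ ι := Equiv.ofBijective φr hbr
  let eC' : (Fin 6 × {c // c ∈ C₆}) ⊕ (Fin 2 × {c // c ∈ C₂}) ≃ ι := Equiv.ofBijective φc hbc
  -- cardinalities
  have hmovedR : (univ.filter (fun i => π (π i) ≠ i)).card = 6 * R₆.card := perm62_card_moved π hπ6 hπ3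
  have hmovedC : (univ.filter (fun j => κ (κ j) ≠ j)).card = 6 * C₆.card := perm62_card_moved κ hκ6 hκ3
  have hcardR : Fintype.card ι = 6 * R₆.card + 2 * R₂.card := by
    have h := Fintype.card_congr eR
    rw [Fintype.card_sum, Fintype.card_prod, Fintype.card_prod, Fintype.card_fin, Fintype.card_fin,
      Fintype.card_coe, Fintype.card_coe] at h
    omega
  have hcardC : Fintype.card ι = 6 * C₆.card + 2 * C₂.card := by
    have h := Fintype.card_congr eC'
    rw [Fintype.card_sum, Fintype.card_prod, Fintype.card_prod, Fintype.card_fin, Fintype.card_fin,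
      Fintype.card_coe, Fintype.card_coe] at h
    omega
  have hsplitR : (univ.filter (fun i => π (π i) = i)).card + (univ.filter (fun i => π (π i) ≠ i)).card =
      Fintype.card ι := Finset.card_filter_add_card_filter_not _
  have hsplitC : (univ.filter (fun j => κ (κ j) = j)).card + (univ.filter (fun j => κ (κ j) ≠ j)).card =
      Fintype.card ι := Finset.card_filter_add_card_filter_not _
  -- the numbers of fixed points of π² and κ² agree (trace lemma on g²)
  have haut2 : IsSignedAut H (π ^ 2) (κ ^ 2) (fun i => d i * d (π i)) (fun j => e j * e (κ j)) := by
    refine ⟨fun i => pm_mul (hd i) (hd (π i)), fun j => pm_mul (he j) (he (κ j)), fun i j => ?_⟩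
    have p2π : (π ^ 2) i = π (π i) := by simp [pow_two]
    have p2κ : (κ ^ 2) j = κ (κ j) := by simp [pow_two]
    rw [p2π, p2κ, hA, hA]
    ring
  have htr := signedAut_trace hH hcardι haut2
  have hfiltR : univ.filter (fun i => (π ^ 2) i = i) = univ.filter (fun i => π (π i) = i) := by
    ext i; simp [pow_two]
  have hfiltC : univ.filter (fun j => (κ ^ 2) j = j) = univ.filter (fun j => κ (κ j) = j) := by
    ext j; simp [pow_two]
  rw [hfiltR, hfiltC] at htr
  have hsumR : ∑ i ∈ univ.filter (fun i => π (π i) = i), d i * d (π i) =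
      -((univ.filter (fun i => π (π i) = i)).card : ℤ) := by
    rw [Finset.sum_congr rfl (fun i hi => hd2 i (mem_filter.mp hi).2)]
    simp
  have hsumC : ∑ j ∈ univ.filter (fun j => κ (κ j) = j), e j * e (κ j) =
      -((univ.filter (fun j => κ (κ j) = j)).card : ℤ) := by
    rw [Finset.sum_congr rfl (fun j hj => he2 j (mem_filter.mp hj).2)]
    simp
  have hfix : (univ.filter (fun i => π (π i) = i)).card = (univ.filter (fun j => κ (κ j) = j)).card := by
    have h := htr
    rw [hsumR, hsumC] at h
    exact_mod_cast neg_injective h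
  have h66 : R₆.card = C₆.card := by omega
  have h22 : R₂.card = C₂.card := by omega
  obtain ⟨g₆⟩ : Nonempty ({c // c ∈ R₆} ≃ {c // c ∈ C₆}) :=
    Fintype.card_eq.mp (by rw [Fintype.card_coe, Fintype.card_coe]; exact h66)
  obtain ⟨g₂⟩ : Nonempty ({c // c ∈ R₂} ≃ {c // c ∈ C₂}) :=
    Fintype.card_eq.mp (by rw [Fintype.card_coe, Fintype.card_coe]; exact h22)
  let eC : (Fin 6 × {c // c ∈ R₆}) ⊕ (Fin 2 × {c // c ∈ R₂}) ≃ ι :=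
    (Equiv.sumCongr ((Equiv.refl (Fin 6)).prodCongr g₆) ((Equiv.refl (Fin 2)).prodCongr g₂)).trans eC'
  -- the standard shift and its intertwining
  set σ : Equiv.Perm ((Fin 6 × {c // c ∈ R₆}) ⊕ (Fin 2 × {c // c ∈ R₂})) :=
    Equiv.sumCongr ((finRotate 6).prodCongr (Equiv.refl _)) ((finRotate 2).prodCongr (Equiv.refl _)) with hσdef
  have hσl : ∀ (p : Fin 6) (c : {c // c ∈ R₆}), σ (Sum.inl (p, c)) = Sum.inl (p + 1, c) := by
    intro p c; simp [hσdef]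
  have hσr : ∀ (p : Fin 2) (c : {c // c ∈ R₂}), σ (Sum.inr (p, c)) = Sum.inr (p + 1, c) := by
    intro p c; simp [hσdef]
  have heRl : ∀ (p : Fin 6) (c : {c // c ∈ R₆}), eR (Sum.inl (p, c)) = (π ^ (p : ℕ)) c.1 := fun _ _ => rfl
  have heRr : ∀ (p : Fin 2) (c : {c // c ∈ R₂}), eR (Sum.inr (p, c)) = (π ^ (p : ℕ)) c.1 := fun _ _ => rfl
  have heCl : ∀ (p : Fin 6) (c : {c // c ∈ R₆}), eC (Sum.inl (p, c)) = (κ ^ (p : ℕ)) (g₆ c).1 := fun _ _ => rfl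
  have heCr : ∀ (p : Fin 2) (c : {c // c ∈ R₂}), eC (Sum.inr (p, c)) = (κ ^ (p : ℕ)) (g₂ c).1 := fun _ _ => rfl
  have heR : ∀ x, eR (σ x) = π (eR x) := by
    rintro (⟨p, c⟩ | ⟨p, c⟩)
    · rw [hσl, heRl, heRl]
      fin_cases p <;> simp [pow_succ, hπ6]
    · rw [hσr, heRr, heRr]
      have h2 := (mem_filter.mp c.2).2.1
      fin_cases p <;> simp [pow_succ, h2]
  have heC : ∀ x, eC (σ x) = κ (eC x) := by
    rintro (⟨p, c⟩ | ⟨p, c⟩)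
    · rw [hσl, heCl, heCl]
      fin_cases p <;> simp [pow_succ, hκ6]
    · rw [hσr, heCr, heCr]
      have h2 := (mem_filter.mp (g₂ c).2).2.1
      fin_cases p <;> simp [pow_succ, h2]
  -- re-signing
  have hprodπ : ∀ (n : ℕ) (c : ι), (∏ k ∈ range n, d ((π ^ k) c)) = 1 ∨ (∏ k ∈ range n, d ((π ^ k) c)) = -1 := by
    intro n c
    induction n with
    | zero => simp
    | succ n ih => rw [Finset.prod_range_succ]; exact pm_mul ih (hd _)
  have hprodκ : ∀ (n : ℕ) (c : ι), (∏ k ∈ range n, e ((κ ^ k) c)) = 1 ∨ (∏ k ∈ range n, e ((κ ^ k) c)) = -1 := by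
    intro n c
    induction n with
    | zero => simp
    | succ n ih => rw [Finset.prod_range_succ]; exact pm_mul ih (he _)
  set δ : (Fin 6 × {c // c ∈ R₆}) ⊕ (Fin 2 × {c // c ∈ R₂}) → ℤ :=
    Sum.elim (fun x => ∏ k ∈ range (x.1 : ℕ), d ((π ^ k) x.2.1)) (fun x => ∏ k ∈ range (x.1 : ℕ), d ((π ^ k) x.2.1))
    with hδdef
  set ε : (Fin 6 × {c // c ∈ R₆}) ⊕ (Fin 2 × {c // c ∈ R₂}) → ℤ :=
    Sum.elim (fun x => ∏ k ∈ range (x.1 : ℕ), e ((κ ^ k) (g₆ x.2).1))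
      (fun x => ∏ k ∈ range (x.1 : ℕ), e ((κ ^ k) (g₂ x.2).1)) with hεdef
  set d₀ : (Fin 6 × {c // c ∈ R₆}) ⊕ (Fin 2 × {c // c ∈ R₂}) → ℤ :=
    Sum.elim (fun x => if x.1 = 5 then -1 else 1) (fun x => if x.1 = 1 then -1 else 1) with hd₀def
  have hδpm : ∀ x, δ x = 1 ∨ δ x = -1 := by
    rintro (⟨p, c⟩ | ⟨p, c⟩)
    · exact hprodπ _ _
    · exact hprodπ _ _
  have hεpm : ∀ x, ε x = 1 ∨ ε x = -1 := by
    rintro (⟨p, c⟩ | ⟨p, c⟩)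
    · exact hprodκ _ _
    · exact hprodκ _ _
  have hδkey : ∀ x, δ (σ x) * d (eR x) = d₀ x * δ x := by
    rintro (⟨p, c⟩ | ⟨p, c⟩)
    · rw [hσl, heRl]
      simp only [hδdef, hd₀def, Sum.elim_inl]
      have s0 := pm_mul_self (hd c.1)
      have s1 := pm_mul_self (hd (π c.1))
      have s2 := pm_mul_self (hd (π (π c.1)))
      have s3 := pm_mul_self (hd (π (π (π c.1))))
      have s4 := pm_mul_self (hd (π (π (π (π c.1)))))
      have hn := hdneg c.1
      fin_cases p <;> simp [Finset.prod_range_succ, pow_succ]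
      · linear_combination s0
      · linear_combination (d c.1) * s1
      · linear_combination (d c.1 * d (π c.1)) * s2
      · linear_combination (d c.1 * d (π c.1) * d (π (π c.1))) * s3
      · linear_combination (d c.1 * d (π c.1) * d (π (π c.1)) * d (π (π (π c.1)))) * s4
      · have hX := pm_mul_self (pm_mul (pm_mul (pm_mul (pm_mul (hd c.1) (hd (π c.1))) (hd (π (π c.1))))
          (hd (π (π (π c.1))))) (hd (π (π (π (π c.1))))))
        linear_combination (d c.1 * d (π c.1) * d (π (π c.1)) * d (π (π (π c.1))) * d (π (π (π (π c.1))))) * hn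
          - (d (π (π (π (π (π c.1)))))) * hX
    · rw [hσr, heRr]
      simp only [hδdef, hd₀def, Sum.elim_inr]
      have h2 := (mem_filter.mp c.2).2.1
      have s0 := pm_mul_self (hd c.1)
      have hn := hd2 c.1 h2
      fin_cases p <;> simp [pow_succ]
      · linear_combination s0
      · linear_combination (d c.1) * hn - (d (π c.1)) * s0
  have hεkey : ∀ x, ε (σ x) * e (eC x) = d₀ x * ε x := by
    rintro (⟨p, c⟩ | ⟨p, c⟩)
    · rw [hσl, heCl]
      simp only [hεdef, hd₀def, Sum.elim_inl]
      have s0 := pm_mul_self (he (g₆ c).1)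
      have s1 := pm_mul_self (he (κ (g₆ c).1))
      have s2 := pm_mul_self (he (κ (κ (g₆ c).1)))
      have s3 := pm_mul_self (he (κ (κ (κ (g₆ c).1))))
      have s4 := pm_mul_self (he (κ (κ (κ (κ (g₆ c).1)))))
      have hn := heneg (g₆ c).1
      fin_cases p <;> simp [Finset.prod_range_succ, pow_succ]
      · linear_combination s0
      · linear_combination (e (g₆ c).1) * s1
      · linear_combination (e (g₆ c).1 * e (κ (g₆ c).1)) * s2
      · linear_combination (e (g₆ c).1 * e (κ (g₆ c).1) * e (κ (κ (g₆ c).1))) * s3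
      · linear_combination (e (g₆ c).1 * e (κ (g₆ c).1) * e (κ (κ (g₆ c).1)) * e (κ (κ (κ (g₆ c).1)))) * s4
      · have hX := pm_mul_self (pm_mul (pm_mul (pm_mul (pm_mul (he (g₆ c).1) (he (κ (g₆ c).1)))
          (he (κ (κ (g₆ c).1)))) (he (κ (κ (κ (g₆ c).1))))) (he (κ (κ (κ (κ (g₆ c).1))))))
        linear_combination (e (g₆ c).1 * e (κ (g₆ c).1) * e (κ (κ (g₆ c).1)) * e (κ (κ (κ (g₆ c).1))) *
          e (κ (κ (κ (κ (g₆ c).1))))) * hn - (e (κ (κ (κ (κ (κ (g₆ c).1)))))) * hX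
    · rw [hσr, heCr]
      simp only [hεdef, hd₀def, Sum.elim_inr]
      have h2 := (mem_filter.mp (g₂ c).2).2.1
      have s0 := pm_mul_self (he (g₂ c).1)
      have hn := he2 (g₂ c).1 h2
      fin_cases p <;> simp [pow_succ]
      · linear_combination s0
      · linear_combination (e (g₂ c).1) * hn - (e (κ (g₂ c).1)) * s0
  -- the transported, re-signed matrix
  set H' : Matrix ((Fin 6 × {c // c ∈ R₆}) ⊕ (Fin 2 × {c // c ∈ R₂})) ((Fin 6 × {c // c ∈ R₆}) ⊕ (Fin 2 × {c // c ∈ R₂})) ℤ :=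
    fun x y => δ x * ε y * H (eR x) (eC y) with hH'def
  have hH' : IsHadamardMatrix H' := by
    refine ⟨fun x y => ?_, ?_⟩
    · rw [hH'def]
      exact pm_mul (pm_mul (hδpm x) (hεpm y)) (hH.1 _ _)
    · ext x x'
      rw [Matrix.mul_apply, Matrix.smul_apply, Matrix.one_apply]
      simp only [hH'def, transpose_apply, smul_eq_mul]
      have e1 : ∑ y, δ x * ε y * H (eR x) (eC y) * (δ x' * ε y * H (eR x') (eC y))
          = δ x * δ x' * ∑ y, H (eR x) (eC y) * H (eR x') (eC y) := by
        rw [Finset.mul_sum]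
        refine Finset.sum_congr rfl fun y _ => ?_
        have := pm_mul_self (hεpm y)
        linear_combination (δ x * δ x' * H (eR x) (eC y) * H (eR x') (eC y)) * this
      rw [e1, Equiv.sum_comp eC (fun j => H (eR x) j * H (eR x') j)]
      rw [Fintype.card_congr eR]
      by_cases hxx : x = x'
      · subst hxx
        rw [hadamard_row_self H hH, if_pos rfl, pm_mul_self (hδpm x), one_mul, mul_one]
      · have hne : eR x ≠ eR x' := fun h => hxx (eR.injective h)
        rw [hadamard_row_orth H hH hne, if_neg hxx, mul_zero, mul_zero]
  have haut' : IsSignedAut H' σ σ d₀ d₀ := by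
    refine ⟨fun x => ?_, fun x => ?_, fun x y => ?_⟩
    · rcases x with ⟨p, c⟩ | ⟨p, c⟩ <;> simp only [hd₀def, Sum.elim_inl, Sum.elim_inr] <;> split_ifs <;> simp
    · rcases x with ⟨p, c⟩ | ⟨p, c⟩ <;> simp only [hd₀def, Sum.elim_inl, Sum.elim_inr] <;> split_ifs <;> simp
    · show δ (σ x) * ε (σ y) * H (eR (σ x)) (eC (σ y)) = d₀ x * d₀ y * (δ x * ε y * H (eR x) (eC y))
      rw [heR, heC, hA]
      have h1 := hδkey x
      have h2 := hεkey y
      linear_combination (ε (σ y) * e (eC y) * H (eR x) (eC y)) * h1 + (d₀ x * δ x * H (eR x) (eC y)) * h2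
  have hcard' : Fintype.card ((Fin 6 × {c // c ∈ R₆}) ⊕ (Fin 2 × {c // c ∈ R₂})) = 4 * q := by
    rw [Fintype.card_congr eR, hι]
  -- conclusion: |R₆| is even
  rcases Nat.even_or_odd R₆.card with heven | hodd
  · obtain ⟨k, hk⟩ := heven
    rw [hmovedR, hk]
    exact ⟨k, by ring⟩
  · exfalso
    have hA6 : Odd (Fintype.card {c // c ∈ R₆}) := by rw [Fintype.card_coe]; exact hodd
    exact no_hadamard4q_nega6_blockform hq hq12 hcard' hA6 H' hH' haut'

end transfer6ord

section transfer6
variable {ι : Type*} [Fintype ι] [DecidableEq ι]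

/-- **Transfer**, arbitrary index type: under nega cycle signs, `12 ∣ #{i | π² i ≠ i}`. -/
theorem hadamard4q_nega6 {q : ℕ} (hq : q.Prime) (hq12 : q % 12 = 11) {H : Matrix ι ι ℤ}
    (hH : IsHadamardMatrix H) (hι : Fintype.card ι = 4 * q) {π κ : Equiv.Perm ι} {d e : ι → ℤ}
    (haut : IsSignedAut H π κ d e)
    (hπ6 : ∀ i, π (π (π (π (π (π i))))) = i) (hκ6 : ∀ j, κ (κ (κ (κ (κ (κ j))))) = j)
    (hπ3 : ∀ i, π (π (π i)) ≠ i) (hκ3 : ∀ j, κ (κ (κ j)) ≠ j)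
    (hdneg : ∀ i, d i * d (π i) * d (π (π i)) * d (π (π (π i))) * d (π (π (π (π i)))) *
      d (π (π (π (π (π i))))) = -1)
    (heneg : ∀ j, e j * e (κ j) * e (κ (κ j)) * e (κ (κ (κ j))) * e (κ (κ (κ (κ j)))) *
      e (κ (κ (κ (κ (κ j))))) = -1) :
    12 ∣ (univ.filter (fun i => π (π i) ≠ i)).card := by
  classical
  letI : LinearOrder ι := LinearOrder.lift' (Fintype.equivFin ι) (Fintype.equivFin ι).injective
  have h := hadamard4q_nega6_ord hq hq12 (H := H) (by convert hH) hι haut hπ6 hκ6 hπ3 hκ3 hdneg heneg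
  convert h

/-- **H(4q), `q ≡ 11 (mod 12)` prime: an automorphism of order 6 whose cube is fixed-point-free has an even number of
6-cycles, on rows and on columns.**  For a signed automorphism `(π, κ, d, e)` of a Hadamard matrix of order `4q` with
`π⁶ = κ⁶ = 1` and `π³`, `κ³` fixed-point-free: `12 ∣ #{i | π² i ≠ i}` and `12 ∣ #{j | κ² j ≠ j}` (the rows moved by `π²` are
exactly the union of the `6`-cycles).  Covers the open orders `668 = 4·167` and `716 = 4·179`. -/
theorem hadamard4q_aut_order6_cube_fpf {q : ℕ} (hq : q.Prime) (hq12 : q % 12 = 11) {H : Matrix ι ι ℤ}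
    (hH : IsHadamardMatrix H) (hι : Fintype.card ι = 4 * q) {π κ : Equiv.Perm ι} {d e : ι → ℤ}
    (haut : IsSignedAut H π κ d e)
    (hπ6 : ∀ i, π (π (π (π (π (π i))))) = i) (hκ6 : ∀ j, κ (κ (κ (κ (κ (κ j))))) = j)
    (hπ3 : ∀ i, π (π (π i)) ≠ i) (hκ3 : ∀ j, κ (κ (κ j)) ≠ j) :
    12 ∣ (univ.filter (fun i => π (π i) ≠ i)).card ∧ 12 ∣ (univ.filter (fun j => κ (κ j) ≠ j)).card := by
  have hd := haut.1
  have he := haut.2.1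
  have hA := haut.2.2
  have pm_mul : ∀ {a b : ℤ}, (a = 1 ∨ a = -1) → (b = 1 ∨ b = -1) → (a * b = 1 ∨ a * b = -1) := by
    intro a b ha hb
    rcases ha with h | h <;> rcases hb with h' | h' <;> simp [h, h']
  have hmod : Fintype.card ι % 8 = 4 := by rw [hι]; omega
  have hns : ¬ ∃ x y : ℕ, Fintype.card ι = x ^ 2 + y ^ 2 := by
    rw [hι]; exact not_sq_add_sq_four_mul_nat (by omega)
  have hcardι : (Fintype.card ι : ℤ) ≠ 0 := by rw [hι]; push_cast; have := hq.pos; positivity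
  -- the cube as a signed automorphism
  have haut3 : IsSignedAut H (π ^ 3) (κ ^ 3) (fun i => d i * d (π i) * d (π (π i)))
      (fun j => e j * e (κ j) * e (κ (κ j))) := by
    refine ⟨fun i => pm_mul (pm_mul (hd i) (hd (π i))) (hd (π (π i))),
      fun j => pm_mul (pm_mul (he j) (he (κ j))) (he (κ (κ j))), fun i j => ?_⟩
    have p3π : (π ^ 3) i = π (π (π i)) := by simp [pow_succ]
    have p3κ : (κ ^ 3) j = κ (κ (κ j)) := by simp [pow_succ]
    rw [p3π, p3κ, hA, hA, hA]
    ring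
  have hπ3inv : ∀ i, (π ^ 3) ((π ^ 3) i) = i := fun i => by simp [pow_succ, hπ6]
  have hκ3inv : ∀ j, (κ ^ 3) ((κ ^ 3) j) = j := fun j => by simp [pow_succ, hκ6]
  have hπ3f : ∀ i, (π ^ 3) i ≠ i := fun i => by simp [pow_succ]; exact hπ3 i
  have hκ3f : ∀ j, (κ ^ 3) j ≠ j := fun j => by simp [pow_succ]; exact hκ3 j
  obtain ⟨hrow, hcol⟩ := fpf_involution_nega_general hH hmod hns haut3 hπ3inv hκ3inv hπ3f hκ3f
  have hdneg : ∀ i, d i * d (π i) * d (π (π i)) * d (π (π (π i))) * d (π (π (π (π i)))) *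
      d (π (π (π (π (π i))))) = -1 := by
    intro i
    have h := hrow i
    simp only [pow_succ, pow_zero, one_mul, Equiv.Perm.mul_apply] at h
    have := pm_mul_self (pm_mul (pm_mul (hd i) (hd (π i))) (hd (π (π i))))
    linear_combination (d i * d (π i) * d (π (π i))) * h - this
  have heneg : ∀ j, e j * e (κ j) * e (κ (κ j)) * e (κ (κ (κ j))) * e (κ (κ (κ (κ j)))) *
      e (κ (κ (κ (κ (κ j))))) = -1 := by
    intro j
    have h := hcol j
    simp only [pow_succ, pow_zero, one_mul, Equiv.Perm.mul_apply] at h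
    have := pm_mul_self (pm_mul (pm_mul (he j) (he (κ j))) (he (κ (κ j))))
    linear_combination (e j * e (κ j) * e (κ (κ j))) * h - this
  refine ⟨hadamard4q_nega6 hq hq12 hH hι haut hπ6 hκ6 hπ3 hκ3 hdneg heneg, ?_⟩
  exact hadamard4q_nega6 hq hq12 (isHadamard_transpose hH hcardι) hι (isSignedAut_transpose haut)
    hκ6 hπ6 hκ3 hπ3 heneg hdneg

/-- **H(668) instance** (`q = 167`): for a signed automorphism of a Hadamard matrix of order `668` with `π⁶ = κ⁶ = 1` and
`π³`, `κ³` fixed-point-free, the number of `6`-cycles of `π` (and of `κ`) is even: `12 ∣ #{i | π² i ≠ i}`, equivalently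
`#Fix(π²) ≡ 8 (mod 12)` (so `#Fix(g²) ∈ {8, 20, 32, …}`; with `orbitCount_3'`: the number `c₃ = 2a` of `3`-cycles of `g²`
is divisible by `4`). -/
theorem hadamard668_aut_order6_cube_fpf {H : Matrix ι ι ℤ} (hH : IsHadamardMatrix H) (hι : Fintype.card ι = 668)
    {π κ : Equiv.Perm ι} {d e : ι → ℤ} (haut : IsSignedAut H π κ d e)
    (hπ6 : ∀ i, π (π (π (π (π (π i))))) = i) (hκ6 : ∀ j, κ (κ (κ (κ (κ (κ j))))) = j)
    (hπ3 : ∀ i, π (π (π i)) ≠ i) (hκ3 : ∀ j, κ (κ (κ j)) ≠ j) :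
    12 ∣ (univ.filter (fun i => π (π i) ≠ i)).card ∧ 12 ∣ (univ.filter (fun j => κ (κ j) ≠ j)).card ∧
      (univ.filter (fun i => π (π i) = i)).card % 12 = 8 ∧ (univ.filter (fun j => κ (κ j) = j)).card % 12 = 8 := by
  obtain ⟨h1, h2⟩ := hadamard4q_aut_order6_cube_fpf (q := 167) (by norm_num) (by norm_num) hH (by rw [hι]) haut
    hπ6 hκ6 hπ3 hκ3
  have hsR : (univ.filter (fun i => π (π i) = i)).card + (univ.filter (fun i => π (π i) ≠ i)).card =
      Fintype.card ι := Finset.card_filter_add_card_filter_not _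
  have hsC : (univ.filter (fun j => κ (κ j) = j)).card + (univ.filter (fun j => κ (κ j) ≠ j)).card =
      Fintype.card ι := Finset.card_filter_add_card_filter_not _
  refine ⟨h1, h2, ?_, ?_⟩ <;> omega

/-- **H(716) instance** (`q = 179 ≡ 11 (mod 12)`; the order-4 theorem of gen 13 does not cover `716`, this one does). -/
theorem hadamard716_aut_order6_cube_fpf {H : Matrix ι ι ℤ} (hH : IsHadamardMatrix H) (hι : Fintype.card ι = 716)
    {π κ : Equiv.Perm ι} {d e : ι → ℤ} (haut : IsSignedAut H π κ d e)
    (hπ6 : ∀ i, π (π (π (π (π (π i))))) = i) (hκ6 : ∀ j, κ (κ (κ (κ (κ (κ j))))) = j)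
    (hπ3 : ∀ i, π (π (π i)) ≠ i) (hκ3 : ∀ j, κ (κ (κ j)) ≠ j) :
    12 ∣ (univ.filter (fun i => π (π i) ≠ i)).card ∧ 12 ∣ (univ.filter (fun j => κ (κ j) ≠ j)).card :=
  hadamard4q_aut_order6_cube_fpf (q := 179) (by norm_num) (by norm_num) hH (by rw [hι]) haut hπ6 hκ6 hπ3 hκ3

end transfer6

end Summit.Ventures.DiscreteObjects.Hadamard
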